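import Mathlib
import Literature.Analysis.FluidPDE.ClassicalSolution
import Literature.Analysis.FluidPDE.SpaceTimeCalculus
import HarnessLib

/-!
# Route `TautLoopKelvin`, crux `TautLoopLaw` (stmt-NavierStokesRegularity-15249), line
  `Sketch-ideas-r1k1` (Dini–Saks architecture) — auxiliary tools stub `stub_tautLoopOneAux`
  serving the tools stub `stub_tautLoopStepOneStepTools` (one-step splitting consistency)

Pointwise calculus used by the one-step consistency estimate of the "average then transport"
splitting against the Navier–Stokes evolution on a slab `[s, s'] × ℝ³`:

* `tautLoopOne_norm_laplacian_sub_le`: `‖Δf(x) − Δg(y)‖ ≤ 3 ‖D²f(x) − D²g(y)‖` on `ℝ³`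
  (the Laplacian is the trace of the Hessian over an orthonormal frame);
* `tautLoopOne_norm_iteratedFDeriv_two_sub_le`: `‖D²f(y) − D²f(x)‖ ≤ F₃ ‖y − x‖` for `f ∈ C³`
  with `‖D³f‖ ≤ F₃` (mean value inequality);
* `tautLoopOne_adjoint_apply_sub_le`: `‖L† z − v‖ ≤ ‖L − id‖ ‖z‖ + ‖z − v‖`;
* `tautLoopOne_toDual_symm_innerSL_comp`: the Riesz representative of `w ↦ ⟪v, L w⟫` is `L† v`,
  whence the gradient of `y ↦ (∫ₛ^{s'} p(r, y) dr) − (τ/2) ‖U y‖²` is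
  `∫ₛ^{s'} ∇p(r, ·)(x) dr − τ (DU(x))† U(x)` (differentiation under the integral sign for the
  jointly smooth pressure, dominated on `[s, s'] × B̄(x, 1)` by compactness, and
  `D(‖U‖²)(x) w = 2 ⟪U x, DU(x) w⟫`): `tautLoopOne_gradient_potential`;
* `tautLoopOne_time_remainder`: for a classical solution of Navier–Stokes (force `0`) on
  `[s, s']` with `‖u‖ ≤ B₀`, `‖Du‖ ≤ B₁` and `u`, `Du`, `D²u` time-Lipschitz with constant `Bt`,
  `‖u(s') − u(s) − (s' − s)(νΔu(s) − Du(s) u(s)) + ∫ₛ^{s'} ∇p(r) dr‖ ≤ (3ν + B₀ + B₁) Bt (s' − s)²`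
  pointwise (fundamental theorem of calculus in time for the momentum equation and the
  time-Lipschitz bounds).

All statements are folklore multivariable calculus (J. Dieudonné, *Foundations of Modern
Analysis* (1960), (8.5.4) mean value inequality, (8.11.2) differentiation under the integral
sign; A. J. Majda, A. L. Bertozzi, *Vorticity and Incompressible Flow* (2002), §1.2 for the
momentum equation), proved from Mathlib and the space–time calculus of
`Literature.Analysis.FluidPDE.SpaceTimeCalculus`.
-/

noncomputable section

open Set Function Filter Topology MeasureTheory intervalIntegral InnerProductSpace
  Literature.Analysis.FluidPDE
open ContinuousLinearMap (adjoint)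
open scoped InnerProductSpace RealInnerProductSpace Laplacian ContDiff Interval

namespace Summit.NavierStokesRegularity.NavierStokesRegularity.Theorems

set_option linter.dupNamespace false

local notation3 "E3" => EuclideanSpace ℝ (Fin 3)

/-! ## Pointwise linear algebra and calculus -/

/-- **Laplacians against Hessians** on `ℝ³`: `‖Δf(x) − Δg(y)‖ ≤ 3 ‖D²f(x) − D²g(y)‖` for arbitrary
`f g` (no smoothness needed: `Δf(x) = Σᵢ D²f(x)(eᵢ, eᵢ)` over the standard orthonormal frame,
`laplacian_eq_iteratedFDeriv_orthonormalBasis`). [folklore] -/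
theorem tautLoopOne_norm_laplacian_sub_le {F : Type*} [NormedAddCommGroup F] [NormedSpace ℝ F]
    (f g : E3 → F) (x y : E3) :
    ‖Δ f x - Δ g y‖ ≤ 3 * ‖iteratedFDeriv ℝ 2 f x - iteratedFDeriv ℝ 2 g y‖ := by
  set b := EuclideanSpace.basisFun (Fin 3) ℝ
  rw [laplacian_eq_iteratedFDeriv_orthonormalBasis f b,
    laplacian_eq_iteratedFDeriv_orthonormalBasis g b, ← Finset.sum_sub_distrib]
  have hb : ∀ i : Fin 3, ∀ j, ‖(![b i, b i] : Fin 2 → E3) j‖ = 1 := fun i j => by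
    fin_cases j <;> simp [b.orthonormal.1 i]
  calc ‖∑ i, (iteratedFDeriv ℝ 2 f x ![b i, b i] - iteratedFDeriv ℝ 2 g y ![b i, b i])‖
      ≤ ∑ i, ‖iteratedFDeriv ℝ 2 f x ![b i, b i] - iteratedFDeriv ℝ 2 g y ![b i, b i]‖ :=
        norm_sum_le _ _
    _ ≤ ∑ _i : Fin 3, ‖iteratedFDeriv ℝ 2 f x - iteratedFDeriv ℝ 2 g y‖ := by
        refine Finset.sum_le_sum fun i _ => ?_
        have h := (iteratedFDeriv ℝ 2 f x - iteratedFDeriv ℝ 2 g y).le_opNorm ![b i, b i]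
        simpa [hb i] using h
    _ = 3 * ‖iteratedFDeriv ℝ 2 f x - iteratedFDeriv ℝ 2 g y‖ := by simp

/-- **Mean value inequality for the Hessian**: a bound `‖D³f‖ ≤ F₃` on a `C³` map makes `D²f`
Lipschitz, `‖D²f(y) − D²f(x)‖ ≤ F₃ ‖y − x‖` (`‖D(D²f)‖ = ‖D³f‖`). [folklore] -/
theorem tautLoopOne_norm_iteratedFDeriv_two_sub_le {E F : Type*} [NormedAddCommGroup E]
    [NormedSpace ℝ E] [NormedAddCommGroup F] [NormedSpace ℝ F] {f : E → F} {F₃ : ℝ}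
    (hf : ContDiff ℝ 3 f) (hF₃ : ∀ x, ‖iteratedFDeriv ℝ 3 f x‖ ≤ F₃) (x y : E) :
    ‖iteratedFDeriv ℝ 2 f y - iteratedFDeriv ℝ 2 f x‖ ≤ F₃ * ‖y - x‖ := by
  have hd : Differentiable ℝ (iteratedFDeriv ℝ 2 f) :=
    hf.differentiable_iteratedFDeriv (by norm_cast)
  refine convex_univ.norm_image_sub_le_of_norm_fderiv_le (fun z _ => hd z) (fun z _ => ?_)
    (mem_univ x) (mem_univ y)
  rw [norm_fderiv_iteratedFDeriv]
  exact hF₃ z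

/-- **Adjoint transport against the identity**: `‖L† z − v‖ ≤ ‖L − id‖ ‖z‖ + ‖z − v‖`
(`L† z − v = (L − id)† z + (z − v)` and `‖(L − id)†‖ = ‖L − id‖`). [folklore] -/
theorem tautLoopOne_adjoint_apply_sub_le {E : Type*} [NormedAddCommGroup E]
    [InnerProductSpace ℝ E] [CompleteSpace E] (L : E →L[ℝ] E) (z v : E) :
    ‖adjoint L z - v‖ ≤ ‖L - ContinuousLinearMap.id ℝ E‖ * ‖z‖ + ‖z - v‖ := by
  have h : adjoint L z - v = adjoint (L - ContinuousLinearMap.id ℝ E) z + (z - v) := by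
    simp [map_sub]
  rw [h]
  refine norm_add_le_of_le (((adjoint (L - ContinuousLinearMap.id ℝ E)).le_opNorm z).trans ?_)
    le_rfl
  rw [ContinuousLinearMap.adjoint.norm_map]

/-- **Riesz representative of `w ↦ ⟪v, L w⟫`** is `L† v`:
`(toDual)⁻¹ (⟪v, ·⟫ ∘ L) = L† v` (defining property of the adjoint). [folklore] -/
theorem tautLoopOne_toDual_symm_innerSL_comp {E : Type*} [NormedAddCommGroup E]
    [InnerProductSpace ℝ E] [CompleteSpace E] (L : E →L[ℝ] E) (v : E) :
    (toDual ℝ E).symm ((innerSL ℝ v).comp L) = adjoint L v := by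
  have h : (innerSL ℝ v).comp L = toDual ℝ E (adjoint L v) := by
    ext w
    simp [ContinuousLinearMap.adjoint_inner_left]
  rw [h, LinearIsometryEquiv.symm_apply_apply]

/-! ## Time lines and parametric time integrals of jointly smooth fields -/

/-- The time line `r ↦ w(r, x)` of a jointly smooth field is continuous on the time set. [folklore] -/
theorem tautLoopOne_continuousOn_timeLine {F : Type*} [NormedAddCommGroup F] [NormedSpace ℝ F]
    {S : Set ℝ} {w : ℝ → E3 → F} (hw : IsSmoothSpaceTimeOn S w) (x : E3) :
    ContinuousOn (fun r => w r x) S :=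
  hw.continuousOn.comp (continuousOn_id.prodMk continuousOn_const) fun _ hr =>
    mk_mem_prod hr (mem_univ x)

/-- **Differentiation under the time integral** for a jointly smooth scalar field on a slab
`[s, s'] × ℝ³` (`s < s'`): `y ↦ ∫ₛ^{s'} p(r, y) dr` has derivative `∫ₛ^{s'} D(p r)(x) dr` at `x`
(dominated differentiation, `intervalIntegral.hasFDerivAt_integral_of_dominated_of_fderiv_le`,
the bound being the maximum of the jointly continuous `D(p r)(y)` on the compact
`[s, s'] × B̄(x, 1)`; Dieudonné (1960), (8.11.2)). [folklore] -/
theorem tautLoopOne_hasFDerivAt_integral {p : ℝ → E3 → ℝ} {s s' : ℝ} (hss' : s < s')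
    (hp : IsSmoothSpaceTimeOn (Icc s s') p) (x : E3) :
    HasFDerivAt (fun y => ∫ r in s..s', p r y) (∫ r in s..s', fderiv ℝ (p r) x) x := by
  have hDcont : ContinuousOn (fun z : ℝ × E3 => fderiv ℝ (p z.1) z.2) (Icc s s' ×ˢ univ) :=
    hp.continuousOn_fderiv_slice (uniqueDiffOn_Icc hss')
  have hpz : ∀ z, ContinuousOn (fun r => p r z) (Icc s s') := fun z =>
    tautLoopOne_continuousOn_timeLine hp z
  have hDz : ContinuousOn (fun r => fderiv ℝ (p r) x) (Icc s s') :=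
    hDcont.comp (continuousOn_id.prodMk continuousOn_const) fun _ hr => mk_mem_prod hr (mem_univ x)
  -- a uniform bound for the derivative on `[s, s'] × B̄(x, 1)`
  obtain ⟨M, hM⟩ := (isCompact_Icc.prod (isCompact_closedBall x 1)).exists_bound_of_continuousOn
    (hDcont.mono (prod_mono Subset.rfl (subset_univ _)))
  -- measurability on `Ι s s' ⊆ [s, s']`
  have hΙ : Ι s s' ⊆ Icc s s' := by
    rw [uIoc_of_le hss'.le]; exact Ioc_subset_Icc_self
  have hres : (volume : Measure ℝ).restrict (Ι s s') ≤ (volume : Measure ℝ).restrict (Icc s s') :=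
    Measure.restrict_mono hΙ le_rfl
  have hmeas : ∀ z, AEStronglyMeasurable (fun r => p r z)
      ((volume : Measure ℝ).restrict (Ι s s')) := fun z =>
    ((hpz z).aestronglyMeasurable measurableSet_Icc).mono_measure hres
  have hmeas' : AEStronglyMeasurable (fun r => fderiv ℝ (p r) x)
      ((volume : Measure ℝ).restrict (Ι s s')) :=
    (hDz.aestronglyMeasurable measurableSet_Icc).mono_measure hres
  refine intervalIntegral.hasFDerivAt_integral_of_dominated_of_fderiv_le (μ := volume)
    (F := fun y r => p r y) (F' := fun y r => fderiv ℝ (p r) y) (x₀ := x)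
    (bound := fun _ => M) (Metric.ball_mem_nhds x one_pos) (Eventually.of_forall hmeas)
    ((hpz x).intervalIntegrable_of_Icc hss'.le) hmeas' ?_ intervalIntegrable_const ?_
  · exact Eventually.of_forall fun r hr z hz =>
      hM (r, z) (mk_mem_prod (hΙ hr) (Metric.ball_subset_closedBall hz))
  · exact Eventually.of_forall fun r hr z _ =>
      (((hp.contDiff_slice (hΙ hr)).differentiable (by simp)) z).hasFDerivAt

/-- **The potential of the one-step estimate and its gradient.** For a jointly smooth scalar
field `p` on `[s, s'] × ℝ³` (`s < s'`), a `C¹` field `U` and `τ : ℝ`, the function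
`q(y) = (∫ₛ^{s'} p(r, y) dr) − (τ/2) ‖U y‖²` is differentiable with
`∇q(x) = ∫ₛ^{s'} ∇p(r, ·)(x) dr − τ (DU(x))† U(x)` (the gradient passes under the time integral,
the Riesz map commuting with integrals, and `∇(½‖U‖²) = (DU)† U`). [folklore] -/
theorem tautLoopOne_gradient_potential {p : ℝ → E3 → ℝ} {U : E3 → E3} {s s' : ℝ} (hss' : s < s')
    (hp : IsSmoothSpaceTimeOn (Icc s s') p) (hU : ContDiff ℝ 1 U) (τ : ℝ) :
    Differentiable ℝ (fun y => (∫ r in s..s', p r y) - τ / 2 * ‖U y‖ ^ 2) ∧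
    ∀ x, gradient (fun y => (∫ r in s..s', p r y) - τ / 2 * ‖U y‖ ^ 2) x =
      (∫ r in s..s', gradient (p r) x) - τ • adjoint (fderiv ℝ U x) (U x) := by
  have hd : ∀ x, HasFDerivAt (fun y => (∫ r in s..s', p r y) - τ / 2 * ‖U y‖ ^ 2)
      ((∫ r in s..s', fderiv ℝ (p r) x) -
        (τ / 2) • (2 • (innerSL ℝ (U x)).comp (fderiv ℝ U x))) x := by
    intro x
    have h2 : HasFDerivAt (fun y => ‖U y‖ ^ 2) (2 • (innerSL ℝ (U x)).comp (fderiv ℝ U x)) x :=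
      ((hU.differentiable one_ne_zero) x).hasFDerivAt.norm_sq
    exact (tautLoopOne_hasFDerivAt_integral hss' hp x).sub (h2.const_mul (τ / 2))
  refine ⟨fun x => (hd x).differentiableAt, fun x => ?_⟩
  have hint : (toDual ℝ E3).symm (∫ r in s..s', fderiv ℝ (p r) x) =
      ∫ r in s..s', gradient (p r) x := by
    have : (fun r => gradient (p r) x) =
        fun r => (toDual ℝ E3).symm.toLinearIsometry (fderiv ℝ (p r) x) := rfl
    rw [this, LinearIsometry.intervalIntegral_comp_comm]
    rfl
  rw [gradient, (hd x).fderiv, map_sub, hint, LinearIsometryEquiv.map_smul, map_nsmul,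
    tautLoopOne_toDual_symm_innerSL_comp, ← Nat.cast_smul_eq_nsmul ℝ (2 : ℕ), smul_smul]
  norm_num

/-! ## The time side: integrating the momentum equation -/

/-- **Time remainder of the momentum equation.** For a classical Navier–Stokes solution with zero
force on `[s, s'] × ℝ³` (`s < s'`, viscosity `ν ≥ 0`) with `‖u‖ ≤ B₀`, `‖Du‖ ≤ B₁` and `u`, `Du`,
`D²u` time-Lipschitz with constant `Bt`, one has pointwise
`‖u(s', x) − u(s, x) − (s' − s)(νΔu(s)(x) − Du(s)(x) u(s, x)) + ∫ₛ^{s'} ∇p(r)(x) dr‖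
≤ (3ν + B₀ + B₁) Bt (s' − s)²`: by the fundamental theorem of calculus in time and the momentum
equation `∂ᵣu = νΔu − Du u − ∇p`, the left side is `∫ₛ^{s'} (G(r) − G(s)) dr` with
`G(r) = νΔu(r)(x) − Du(r)(x) u(r, x)`, and `‖G(r) − G(s)‖ ≤ (3ν + B₀ + B₁) Bt (r − s)`
(`‖Δf − Δg‖ ≤ 3‖D²f − D²g‖`). [folklore] -/
theorem tautLoopOne_time_remainder {ν B₀ B₁ Bt : ℝ} {u : ℝ → E3 → E3} {p : ℝ → E3 → ℝ}
    {s s' : ℝ} (hss' : s < s') (hν : 0 ≤ ν) (h₁ : 0 ≤ B₁) (hBt : 0 ≤ Bt)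
    (hNS : IsClassicalNSSolutionOn (Icc s s') ν 0 u p)
    (hB₀ : ∀ r ∈ Icc s s', ∀ x, ‖u r x‖ ≤ B₀) (hB₁ : ∀ r ∈ Icc s s', ∀ x, ‖fderiv ℝ (u r) x‖ ≤ B₁)
    (hut : ∀ r ∈ Icc s s', ∀ r' ∈ Icc s s', ∀ x, ‖u r' x - u r x‖ ≤ Bt * |r' - r|)
    (hDut : ∀ r ∈ Icc s s', ∀ r' ∈ Icc s s', ∀ x,
      ‖fderiv ℝ (u r') x - fderiv ℝ (u r) x‖ ≤ Bt * |r' - r|)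
    (hD2ut : ∀ r ∈ Icc s s', ∀ r' ∈ Icc s s', ∀ x,
      ‖iteratedFDeriv ℝ 2 (u r') x - iteratedFDeriv ℝ 2 (u r) x‖ ≤ Bt * |r' - r|) (x : E3) :
    ‖u s' x - u s x - (s' - s) • (ν • Δ (u s) x - fderiv ℝ (u s) x (u s x)) +
        ∫ r in s..s', gradient (p r) x‖ ≤ (3 * ν + B₀ + B₁) * Bt * (s' - s) ^ 2 := by
  have hU : UniqueDiffOn ℝ (Icc s s') := uniqueDiffOn_Icc hss'
  have hs : s ∈ Icc s s' := left_mem_Icc.2 hss'.le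
  have hu := hNS.smooth_velocity
  have hp := hNS.smooth_pressure
  have hB₀0 : 0 ≤ B₀ := (norm_nonneg _).trans (hB₀ s hs x)
  set G : ℝ → E3 := fun r => ν • Δ (u r) x - fderiv ℝ (u r) x (u r x) with hG
  -- the fundamental theorem of calculus in time
  have hFTC : ∫ r in s..s', timeDerivWithin (Icc s s') u r x = u s' x - u s x :=
    integral_eq_sub_of_hasDerivAt_of_le hss'.le (tautLoopOne_continuousOn_timeLine hu x)
      (fun r hr => (hu.hasDerivWithinAt_timeDerivWithin hU (Ioo_subset_Icc_self hr) x).hasDerivAt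
        (Icc_mem_nhds hr.1 hr.2))
      ((tautLoopOne_continuousOn_timeLine (hu.timeDerivWithin hU) x).intervalIntegrable_of_Icc
        hss'.le)
  -- the momentum equation, pointwise in time
  have hmom : ∀ r ∈ Icc s s', timeDerivWithin (Icc s s') u r x = G r - gradient (p r) x := by
    intro r hr
    have h := hNS.momentum r hr x
    simp only [Pi.zero_apply, add_zero, convect_apply] at h
    calc timeDerivWithin (Icc s s') u r x
        = (timeDerivWithin (Icc s s') u r x + fderiv ℝ (u r) x (u r x)) -
            fderiv ℝ (u r) x (u r x) := by abel
      _ = ν • Δ (u r) x - gradient (p r) x - fderiv ℝ (u r) x (u r x) := by rw [h]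
      _ = G r - gradient (p r) x := by simp only [hG]; abel
  -- integrability of the two parts
  have hGc : ContinuousOn G (Icc s s') :=
    ((tautLoopOne_continuousOn_timeLine (hu.laplacian hU) x).const_smul ν).sub
      (tautLoopOne_continuousOn_timeLine (hu.convect hu hU) x)
  have hGi : IntervalIntegrable G volume s s' := hGc.intervalIntegrable_of_Icc hss'.le
  have hPi : IntervalIntegrable (fun r => gradient (p r) x) volume s s' :=
    (tautLoopOne_continuousOn_timeLine (hp.gradient hU) x).intervalIntegrable_of_Icc hss'.le
  have hint_eq : ∫ r in s..s', timeDerivWithin (Icc s s') u r x =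
      (∫ r in s..s', G r) - ∫ r in s..s', gradient (p r) x := by
    rw [← intervalIntegral.integral_sub hGi hPi]
    refine intervalIntegral.integral_congr fun r hr => ?_
    rw [uIcc_of_le hss'.le] at hr
    exact hmom r hr
  -- the left side is `∫ (G r - G s) dr`
  have hid : u s' x - u s x - (s' - s) • G s + ∫ r in s..s', gradient (p r) x =
      ∫ r in s..s', (G r - G s) := by
    rw [intervalIntegral.integral_sub hGi intervalIntegrable_const, intervalIntegral.integral_const,
      ← hFTC, hint_eq]
    abel
  rw [hid]
  -- the integrand is `O(s' - s)`
  have hbound : ∀ r ∈ Ι s s', ‖G r - G s‖ ≤ (3 * ν + B₀ + B₁) * Bt * (s' - s) := by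
    intro r hr
    have hr' : r ∈ Icc s s' := by
      rw [uIoc_of_le hss'.le] at hr; exact Ioc_subset_Icc_self hr
    have hrs : Bt * |r - s| ≤ Bt * (s' - s) := by
      rw [abs_of_nonneg (by linarith [hr'.1])]
      exact mul_le_mul_of_nonneg_left (by linarith [hr'.2]) hBt
    have e1 : ‖Δ (u r) x - Δ (u s) x‖ ≤ 3 * (Bt * (s' - s)) :=
      (tautLoopOne_norm_laplacian_sub_le _ _ x x).trans
        (mul_le_mul_of_nonneg_left ((hD2ut s hs r hr' x).trans hrs) (by norm_num))
    have e2 : ‖fderiv ℝ (u r) x (u r x) - fderiv ℝ (u s) x (u s x)‖ ≤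
        (B₀ + B₁) * (Bt * (s' - s)) := by
      have hdec : fderiv ℝ (u r) x (u r x) - fderiv ℝ (u s) x (u s x) =
          (fderiv ℝ (u r) x - fderiv ℝ (u s) x) (u r x) + fderiv ℝ (u s) x (u r x - u s x) := by
        simp only [sub_apply, map_sub]; abel
      rw [hdec]
      have f1 : ‖(fderiv ℝ (u r) x - fderiv ℝ (u s) x) (u r x)‖ ≤ Bt * (s' - s) * B₀ :=
        ((fderiv ℝ (u r) x - fderiv ℝ (u s) x).le_opNorm _).trans
          (mul_le_mul ((hDut s hs r hr' x).trans hrs) (hB₀ r hr' x) (norm_nonneg _)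
            (by positivity))
      have f2 : ‖fderiv ℝ (u s) x (u r x - u s x)‖ ≤ B₁ * (Bt * (s' - s)) :=
        ((fderiv ℝ (u s) x).le_of_opNorm_le (hB₁ s hs x) _).trans
          (mul_le_mul_of_nonneg_left ((hut s hs r hr' x).trans hrs) h₁)
      calc _ ≤ Bt * (s' - s) * B₀ + B₁ * (Bt * (s' - s)) := norm_add_le_of_le f1 f2
        _ = (B₀ + B₁) * (Bt * (s' - s)) := by ring
    calc ‖G r - G s‖ = ‖ν • (Δ (u r) x - Δ (u s) x) -
          (fderiv ℝ (u r) x (u r x) - fderiv ℝ (u s) x (u s x))‖ := by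
          simp only [hG, smul_sub]; congr 1; abel
      _ ≤ ‖ν • (Δ (u r) x - Δ (u s) x)‖ +
            ‖fderiv ℝ (u r) x (u r x) - fderiv ℝ (u s) x (u s x)‖ := norm_sub_le _ _
      _ ≤ ν * (3 * (Bt * (s' - s))) + (B₀ + B₁) * (Bt * (s' - s)) := by
          rw [norm_smul, Real.norm_of_nonneg hν]
          exact add_le_add (mul_le_mul_of_nonneg_left e1 hν) e2
      _ = (3 * ν + B₀ + B₁) * Bt * (s' - s) := by ring
  calc ‖∫ r in s..s', (G r - G s)‖ ≤ (3 * ν + B₀ + B₁) * Bt * (s' - s) * |s' - s| :=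
        norm_integral_le_of_norm_le_const hbound
    _ = (3 * ν + B₀ + B₁) * Bt * (s' - s) ^ 2 := by
        rw [abs_of_pos (sub_pos.2 hss')]; ring


/-! ## The registered auxiliary tools stub -/

/-- **Auxiliary tools stub `stub_tautLoopOneAux`** (registered; serves the tools stub
`stub_tautLoopStepOneStepTools` of line `Sketch-ideas-r1k1`): the conjunction, specialised to
`ℝ³`, of (1) `‖Δf(x) − Δg(y)‖ ≤ 3‖D²f(x) − D²g(y)‖`, (2) the mean value inequality for the
Hessian, (3) `‖L† z − v‖ ≤ ‖L − id‖‖z‖ + ‖z − v‖`, (4) differentiability and gradient of the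
potential `(∫ₛ^{s'} p dr) − (τ/2)‖U‖²`, (5) the time remainder of the integrated momentum
equation, with all binders explicit. [folklore] -/
theorem stub_tautLoopOneAux : (∀ (f g : EuclideanSpace ℝ (Fin 3) → EuclideanSpace ℝ (Fin 3)) (x y
    : EuclideanSpace ℝ (Fin 3)), ‖Laplacian.laplacian f x - Laplacian.laplacian g y‖ ≤ 3 *
    ‖iteratedFDeriv ℝ 2 f x - iteratedFDeriv ℝ 2 g y‖) ∧ (∀ (f : EuclideanSpace ℝ (Fin 3) →
    EuclideanSpace ℝ (Fin 3)) (F₃ : ℝ), ContDiff ℝ 3 f → (∀ x, ‖iteratedFDeriv ℝ 3 f x‖ ≤ F₃) → ∀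
    x y, ‖iteratedFDeriv ℝ 2 f y - iteratedFDeriv ℝ 2 f x‖ ≤ F₃ * ‖y - x‖) ∧ (∀ (L :
    EuclideanSpace ℝ (Fin 3) →L[ℝ] EuclideanSpace ℝ (Fin 3)) (z v : EuclideanSpace ℝ (Fin 3)),
    ‖ContinuousLinearMap.adjoint L z - v‖ ≤ ‖L - ContinuousLinearMap.id ℝ (EuclideanSpace ℝ (Fin
    3))‖ * ‖z‖ + ‖z - v‖) ∧ (∀ (p : ℝ → EuclideanSpace ℝ (Fin 3) → ℝ) (U : EuclideanSpace ℝ (Fin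
    3) → EuclideanSpace ℝ (Fin 3)) (s s' τ : ℝ), s < s' →
    Literature.Analysis.FluidPDE.IsSmoothSpaceTimeOn (Set.Icc s s') p → ContDiff ℝ 1 U →
    Differentiable ℝ (fun y => (∫ r in s..s', p r y) - τ / 2 * ‖U y‖ ^ 2) ∧ ∀ x, gradient (fun y
    => (∫ r in s..s', p r y) - τ / 2 * ‖U y‖ ^ 2) x = (∫ r in s..s', gradient (p r) x) - τ •
    ContinuousLinearMap.adjoint (fderiv ℝ U x) (U x)) ∧ (∀ (ν B₀ B₁ Bt : ℝ) (u : ℝ →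
    EuclideanSpace ℝ (Fin 3) → EuclideanSpace ℝ (Fin 3)) (p : ℝ → EuclideanSpace ℝ (Fin 3) → ℝ) (s
    s' : ℝ), s < s' → 0 ≤ ν → 0 ≤ B₁ → 0 ≤ Bt →
    Literature.Analysis.FluidPDE.IsClassicalNSSolutionOn (Set.Icc s s') ν 0 u p → (∀ r ∈ Set.Icc s
    s', ∀ x, ‖u r x‖ ≤ B₀) → (∀ r ∈ Set.Icc s s', ∀ x, ‖fderiv ℝ (u r) x‖ ≤ B₁) → (∀ r ∈ Set.Icc s
    s', ∀ r' ∈ Set.Icc s s', ∀ x, ‖u r' x - u r x‖ ≤ Bt * |r' - r|) → (∀ r ∈ Set.Icc s s', ∀ r' ∈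
    Set.Icc s s', ∀ x, ‖fderiv ℝ (u r') x - fderiv ℝ (u r) x‖ ≤ Bt * |r' - r|) → (∀ r ∈ Set.Icc s
    s', ∀ r' ∈ Set.Icc s s', ∀ x, ‖iteratedFDeriv ℝ 2 (u r') x - iteratedFDeriv ℝ 2 (u r) x‖ ≤ Bt
    * |r' - r|) → ∀ x, ‖u s' x - u s x - (s' - s) • (ν • Laplacian.laplacian (u s) x - fderiv ℝ (u
    s) x (u s x)) + ∫ r in s..s', gradient (p r) x‖ ≤ (3 * ν + B₀ + B₁) * Bt * (s' - s) ^ 2) :=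
  ⟨fun f g x y => tautLoopOne_norm_laplacian_sub_le f g x y,
    fun _f _F₃ hf hF₃ x y => tautLoopOne_norm_iteratedFDeriv_two_sub_le hf hF₃ x y,
    fun L z v => tautLoopOne_adjoint_apply_sub_le L z v,
    fun _p _U _s _s' τ hss' hp hU => tautLoopOne_gradient_potential hss' hp hU τ,
    fun _ν _B₀ _B₁ _Bt _u _p _s _s' hss' hν h₁ hBt hNS hB₀ hB₁ hut hDut hD2ut x =>
      tautLoopOne_time_remainder hss' hν h₁ hBt hNS hB₀ hB₁ hut hDut hD2ut x⟩

end Summit.NavierStokesRegularity.NavierStokesRegularity.Theorems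

end
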